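import Summits.PneNP.PneNP.Theorems.OneSliceShallowSliceBoundInfluence
import Summits.PneNP.PneNP.Theorems.OneSliceShallowSliceBoundSubcubeCount
import Summits.PneNP.PneNP.Theorems.OneSliceShallowSliceBoundSubcubeStep
import Literature.Computability.Complexity.RossmanMonotoneClique

/-!
# Route OneSlice, item `ShallowSliceBound` (stmt-PneNP-14083): shallow monotone circuits are not sharp on slices

Helper file (prover seat, 2026-08-16), def-free. **Leg B** of the proof of `ShallowSliceBound`: for every
depth `d`, size exponent `c`, window exponent `θ > 0` and `ε > 0` there is `j₀` such that on ANY finite cube,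
for `j₀ ≤ j ≤ t ≤ j + j^{1-θ}` with `4t ≤ N`, every circuit over `acBasis` of `acDepth ≤ d` and `≤ j^c` gates
computing a MONOTONE function has slice averages `a_t ≤ a_j + ε` (`shallow_not_sharp`; the monotone, slice
version of "bounded-depth circuits have no sharp thresholds", Linial–Mansour–Nisan / Boppana; cf.
Gamarnik–Mossel–Zadik arXiv:2311.04204 Thm 2.2 for the product-measure statement).

Proof (random sub-cubes of the UNIFORM cube as the dial, no biased measures): the normalised averages
`Φ(r)/(C(N,r)2^N)` of `#{(T,y) : |T| = r, g(y ∧ 1_T) = 1}` are `Bin(r,½)`-mixtures of the slice averages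
(`…SubcubeCount.lean`), so by Chebyshev `Φ(2(j-w₁)) ≲ a_j` and `Φ(2(t+w₂)) ≳ a_t` with `wᵢ ≈ √(K·level)`;
and they drift by at most `Λ (r₂-r₁)/(2(r₁+1))` (`…SubcubeStep.lean`), where `2^N Λ` bounds the pivotal edges of
every restriction `g(· ∧ 1_T)` — polylogarithmic in `j` for shallow circuits (`…Influence.lean`, Tal's Fourier
tails). Since `r₂ - r₁ = O(j^{1-θ} + √j)` and `r₁ ≈ 2j`, the drift is `polylog(j) · j^{-min(θ,1/2)} → 0`.
-/

set_option linter.dupNamespace false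

noncomputable section

namespace Summit.PneNP.PneNP.Theorems.ShallowSliceBound

open Finset Filter Literature.Computability.Complexity
open Summit.PneNP.PneNP.Cruxes.SliceACZero.RussoWindowLadder (wt sliceAvg binomPMF upPivotal binomPMF_nonneg)
open Summit.PneNP.PneNP.Cruxes.SliceACZero.RussoWindowLadder.BinomialHazard (sum_sq_mul_binomPMF_le)
open scoped Topology

/-! ### Chebyshev tails of `Bin(2m, 1/2)` -/

/-- Upper Chebyshev tail of `Bin(2m, ½)`: `Pr[X > m + w] ≤ m / w²`. [folklore] -/
theorem binom_half_upper_tail {m w : ℕ} (hm : 0 < m) (hw : 0 < w) :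
    ∑ ℓ ∈ Ioc (m + w) (2 * m), binomPMF (2 * m) (1 / 2) ℓ ≤ (m : ℝ) / (w : ℝ) ^ 2 := by
  have hcheb := sum_sq_mul_binomPMF_le (N := 2 * m) (j := m) (by omega)
  have hq : (m : ℝ) / ((2 * m : ℕ) : ℝ) = 1 / 2 := by
    rw [Nat.cast_mul, Nat.cast_two]; field_simp
  rw [hq] at hcheb
  have hw2 : (0 : ℝ) < (w : ℝ) ^ 2 := by positivity
  rw [le_div_iff₀ hw2]
  have hnn : ∀ ℓ, 0 ≤ binomPMF (2 * m) (1 / 2) ℓ := fun ℓ => binomPMF_nonneg _ (by norm_num) (by norm_num) ℓ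
  calc (∑ ℓ ∈ Ioc (m + w) (2 * m), binomPMF (2 * m) (1 / 2) ℓ) * (w : ℝ) ^ 2
      = ∑ ℓ ∈ Ioc (m + w) (2 * m), (w : ℝ) ^ 2 * binomPMF (2 * m) (1 / 2) ℓ := by rw [sum_mul]; exact sum_congr rfl fun _ _ => mul_comm _ _
    _ ≤ ∑ ℓ ∈ Ioc (m + w) (2 * m), ((ℓ : ℝ) - m) ^ 2 * binomPMF (2 * m) (1 / 2) ℓ := by
        refine sum_le_sum fun ℓ hℓ => mul_le_mul_of_nonneg_right ?_ (hnn ℓ)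
        rw [mem_Ioc] at hℓ
        have : (w : ℝ) ≤ (ℓ : ℝ) - m := by
          have : ((m + w : ℕ) : ℝ) < ℓ := by exact_mod_cast hℓ.1
          push_cast at this; linarith
        exact pow_le_pow_left₀ (by positivity) this 2
    _ ≤ ∑ ℓ ∈ range (2 * m + 1), ((ℓ : ℝ) - m) ^ 2 * binomPMF (2 * m) (1 / 2) ℓ :=
        sum_le_sum_of_subset_of_nonneg (fun ℓ hℓ => by rw [mem_Ioc] at hℓ; rw [mem_range]; omega)
          fun ℓ _ _ => mul_nonneg (sq_nonneg _) (hnn ℓ)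
    _ ≤ m := hcheb

/-- Lower Chebyshev tail of `Bin(2m, ½)`: `Pr[X < m - w] ≤ m / w²` (levels `< t` with `t + w ≤ m`). [folklore] -/
theorem binom_half_lower_tail {m w t : ℕ} (hm : 0 < m) (hw : 0 < w) (ht : t + w ≤ m) :
    ∑ ℓ ∈ range t, binomPMF (2 * m) (1 / 2) ℓ ≤ (m : ℝ) / (w : ℝ) ^ 2 := by
  have hcheb := sum_sq_mul_binomPMF_le (N := 2 * m) (j := m) (by omega)
  have hq : (m : ℝ) / ((2 * m : ℕ) : ℝ) = 1 / 2 := by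
    rw [Nat.cast_mul, Nat.cast_two]; field_simp
  rw [hq] at hcheb
  have hw2 : (0 : ℝ) < (w : ℝ) ^ 2 := by positivity
  rw [le_div_iff₀ hw2]
  have hnn : ∀ ℓ, 0 ≤ binomPMF (2 * m) (1 / 2) ℓ := fun ℓ => binomPMF_nonneg _ (by norm_num) (by norm_num) ℓ
  calc (∑ ℓ ∈ range t, binomPMF (2 * m) (1 / 2) ℓ) * (w : ℝ) ^ 2
      = ∑ ℓ ∈ range t, (w : ℝ) ^ 2 * binomPMF (2 * m) (1 / 2) ℓ := by rw [sum_mul]; exact sum_congr rfl fun _ _ => mul_comm _ _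
    _ ≤ ∑ ℓ ∈ range t, ((ℓ : ℝ) - m) ^ 2 * binomPMF (2 * m) (1 / 2) ℓ := by
        refine sum_le_sum fun ℓ hℓ => mul_le_mul_of_nonneg_right ?_ (hnn ℓ)
        rw [mem_range] at hℓ
        have h1 : (w : ℝ) ≤ (m : ℝ) - ℓ := by
          have : ((t + w : ℕ) : ℝ) ≤ m := by exact_mod_cast ht
          have : (ℓ : ℝ) < t := by exact_mod_cast hℓ
          push_cast at *; linarith
        calc (w : ℝ) ^ 2 ≤ ((m : ℝ) - ℓ) ^ 2 := pow_le_pow_left₀ (by positivity) h1 2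
          _ = ((ℓ : ℝ) - m) ^ 2 := by ring
    _ ≤ ∑ ℓ ∈ range (2 * m + 1), ((ℓ : ℝ) - m) ^ 2 * binomPMF (2 * m) (1 / 2) ℓ :=
        sum_le_sum_of_subset_of_nonneg (range_subset_range.2 (by omega)) fun ℓ _ _ => mul_nonneg (sq_nonneg _) (hnn ℓ)
    _ ≤ m := hcheb

/-! ### Asymptotics: `polylog(j) · j^{-θ} → 0` -/

/-- Eventually `A (log j)^d j^{-θ} ≤ ε` (`θ, ε > 0`). [folklore] -/
theorem exists_polylog_mul_rpow_neg_le (A : ℝ) (d : ℕ) {θ ε : ℝ} (hθ : 0 < θ) (hε : 0 < ε) :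
    ∃ j₀ : ℕ, ∀ j : ℕ, j₀ ≤ j → A * (Real.log j) ^ d * (j : ℝ) ^ (-θ) ≤ ε := by
  have h := (isLittleO_log_rpow_rpow_atTop (d : ℝ) hθ).tendsto_div_nhds_zero
  have h2 : Tendsto (fun j : ℕ => A * (Real.log j ^ (d : ℝ) / (j : ℝ) ^ θ)) atTop (𝓝 (A * 0)) :=
    (h.comp tendsto_natCast_atTop_atTop).const_mul A
  rw [mul_zero] at h2
  obtain ⟨j₀, hj₀⟩ := eventually_atTop.1 (h2.eventually (eventually_le_nhds hε))
  refine ⟨max j₀ 1, fun j hj => ?_⟩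
  have hj1 : (1 : ℝ) ≤ j := by exact_mod_cast (le_max_right j₀ 1).trans hj
  have := hj₀ j ((le_max_left _ _).trans hj)
  rw [Real.rpow_natCast, Real.rpow_neg (by linarith), ← div_eq_mul_inv] at *
  rwa [mul_div_assoc]

/-! ### Leg B -/

/-- Elementary: `(Nat.sqrt n + 1 : ℝ) ≤ √n + 1` and `n < (Nat.sqrt n + 1)²`. [folklore] -/
theorem natSqrt_succ_le (n : ℕ) : ((Nat.sqrt n + 1 : ℕ) : ℝ) ≤ Real.sqrt n + 1 := by
  have h := Nat.sqrt_le' n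
  have : (Nat.sqrt n : ℝ) ≤ Real.sqrt n := by
    rw [Real.le_sqrt (Nat.cast_nonneg _) (Nat.cast_nonneg _)]
    exact_mod_cast h
  push_cast; linarith

/-- **Leg B: shallow circuits computing monotone functions are not sharp on slices.** For `d, c, θ > 0, ε > 0`
there is `j₀` such that on every finite cube, for `j₀ ≤ j ≤ t ≤ j + j^{1-θ}` with `4t ≤ N`, every circuit over
`acBasis` of `acDepth ≤ d` and at most `j^c` gates whose function is monotone has `a_t ≤ a_j + ε`.
(Registered sub-goal `shallow_not_sharp` of stmt-PneNP-14083.) [cite: Tal2017, Theorem 3.6; Boppana1997] -/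
theorem shallow_not_sharp :
    ∀ (d c : ℕ) (θ : ℝ), 0 < θ → ∀ ε : ℝ, 0 < ε → ∃ j₀ : ℕ, ∀ (ι : Type) [Fintype ι] [DecidableEq ι] (j t : ℕ),
      j₀ ≤ j → j ≤ t → (t : ℝ) ≤ j + (j : ℝ) ^ (1 - θ) → 4 * t ≤ Fintype.card ι → ∀ D : Circuit ι,
      D.IsOver acBasis → Monotone D.eval → D.acDepth ≤ d → D.size ≤ j ^ c →
        sliceAvg D.eval t ≤ sliceAvg D.eval j + ε := by
  intro d c θ hθ ε hε
  -- constants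
  set d' : ℕ := max d 1 with hd'
  have hd'1 : 1 ≤ d' := le_max_right _ _
  obtain ⟨CΛ, hCΛ⟩ : ∃ C : ℝ, C = (ACForm.cA : ℝ) ^ (d' + 2) * (ACForm.cB : ℝ) ^ (d' + 2) / Real.log 2 := ⟨_, rfl⟩
  have hl2 := Real.log_pos (by norm_num : (1 : ℝ) < 2)
  have hCΛ0 : 0 < CΛ := by
    have hA : (0 : ℝ) < ACForm.cA := by unfold ACForm.cA; norm_num
    have hB : (0 : ℝ) < ACForm.cB := by unfold ACForm.cB ACForm.B0; norm_num
    rw [hCΛ]; positivity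
  obtain ⟨K, hK⟩ : ∃ K : ℕ, K = ⌈6 / ε⌉₊ + 1 := ⟨_, rfl⟩
  have hK1 : (1 : ℝ) ≤ K := by
    rw [hK]; push_cast; linarith [(Nat.cast_nonneg ⌈6 / ε⌉₊ : (0 : ℝ) ≤ _)]
  have hK0 : (0 : ℝ) < K := by linarith
  have hKε : 3 / (K : ℝ) ≤ ε / 2 := by
    rw [div_le_div_iff₀ hK0 two_pos]
    have : (6 / ε : ℝ) ≤ K := by
      rw [hK]; push_cast
      linarith [Nat.le_ceil (6 / ε)]
    rw [div_le_iff₀ hε] at this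
    linarith
  set θ' : ℝ := min θ (1 / 2) with hθ'
  have hθ'0 : 0 < θ' := lt_min hθ (by norm_num)
  -- the drift constant and its asymptotics
  set A : ℝ := CΛ * (5 * ((c : ℝ) + 2)) ^ d' * (3 + 2 * Real.sqrt (2 * K)) with hA
  obtain ⟨j₁, hj₁⟩ := exists_polylog_mul_rpow_neg_le A d' hθ'0 (half_pos hε)
  refine ⟨max j₁ (16 * K + 16), ?_⟩
  intro ι _ _ j t hj hjt htj h4t D hD hmono hdep hsize
  -- sizes
  have hjj₁ : j₁ ≤ j := (le_max_left _ _).trans hj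
  have hjK : 16 * K + 16 ≤ j := (le_max_right _ _).trans hj
  have hj16 : 16 ≤ j := by omega
  set N := Fintype.card ι with hN
  have hjR : (16 : ℝ) ≤ j := by exact_mod_cast hj16
  have hjpos : (0 : ℝ) < j := by linarith
  have hjKR : 16 * (K : ℝ) ≤ j := by exact_mod_cast (show 16 * K ≤ j by omega)
  have htR : (j : ℝ) ≤ t := by exact_mod_cast hjt
  have ht2j : (t : ℝ) ≤ 2 * j := by
    have : (j : ℝ) ^ (1 - θ) ≤ (j : ℝ) ^ (1 : ℝ) := Real.rpow_le_rpow_of_exponent_le (by linarith) (by linarith)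
    rw [Real.rpow_one] at this; linarith
  -- the two widths
  set w₁ : ℕ := Nat.sqrt (K * j) + 1 with hw₁
  set w₂ : ℕ := Nat.sqrt (K * t) + 1 with hw₂
  have hw₁pos : 0 < w₁ := Nat.succ_pos _
  have hw₂pos : 0 < w₂ := Nat.succ_pos _
  have hw₁sq : K * j < w₁ ^ 2 := Nat.lt_succ_sqrt' _
  have hw₂sq : K * t < w₂ ^ 2 := Nat.lt_succ_sqrt' _
  have hsqrtKj : Real.sqrt ((K * j : ℕ) : ℝ) ≤ (j : ℝ) / 4 := by
    rw [Real.sqrt_le_left (by positivity)]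
    push_cast; nlinarith only [mul_le_mul_of_nonneg_left hjKR hjpos.le]
  have hsqrtKt : Real.sqrt ((K * t : ℕ) : ℝ) ≤ (t : ℝ) / 4 := by
    rw [Real.sqrt_le_left (by positivity)]
    have : 16 * (K : ℝ) ≤ t := hjKR.trans htR
    push_cast; nlinarith only [mul_le_mul_of_nonneg_left this (hjpos.le.trans htR)]
  have hw₁R : (w₁ : ℝ) ≤ (j : ℝ) / 4 + 1 := (natSqrt_succ_le _).trans (by linarith)
  have hw₂R : (w₂ : ℝ) ≤ (t : ℝ) / 4 + 1 := (natSqrt_succ_le _).trans (by linarith)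
  have hw₂R' : (w₂ : ℝ) ≤ Real.sqrt (2 * K) * Real.sqrt j + 1 := by
    refine (natSqrt_succ_le _).trans ?_
    have : Real.sqrt ((K * t : ℕ) : ℝ) ≤ Real.sqrt (2 * K) * Real.sqrt j := by
      rw [← Real.sqrt_mul (by positivity)]
      exact Real.sqrt_le_sqrt (by push_cast; nlinarith only [mul_le_mul_of_nonneg_left ht2j hK0.le])
    linarith only [this]
  have hw₁R' : (w₁ : ℝ) ≤ Real.sqrt (2 * K) * Real.sqrt j + 1 := by
    refine (natSqrt_succ_le _).trans ?_
    have : Real.sqrt ((K * j : ℕ) : ℝ) ≤ Real.sqrt (2 * K) * Real.sqrt j := by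
      rw [← Real.sqrt_mul (by positivity)]
      exact Real.sqrt_le_sqrt (by push_cast; nlinarith only [mul_nonneg hK0.le hjpos.le])
    linarith only [this]
  have hw₁j : 2 * w₁ ≤ j := by
    have : 2 * (w₁ : ℝ) ≤ j := by linarith
    exact_mod_cast this
  have hw₂t : w₂ ≤ t := by
    have : (w₂ : ℝ) ≤ t := by linarith
    exact_mod_cast this
  -- the two radii
  set m₁ : ℕ := j - w₁ with hm₁
  set m₂ : ℕ := t + w₂ with hm₂
  have hm₁pos : 0 < m₁ := by omega
  have hm₂pos : 0 < m₂ := by omega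
  have hjm : j = m₁ + w₁ := by omega
  have hr₁r₂ : 2 * m₁ ≤ 2 * m₂ := by omega
  have hr₂N : 2 * m₂ ≤ N := by omega
  have hr₁N : 2 * m₁ ≤ N := hr₁r₂.trans hr₂N
  have hjN : j ≤ N := by omega
  have htN : t ≤ N := by omega
  -- the pivotality bound
  set s' : ℕ := j ^ c + 2 with hs'
  obtain ⟨Λ, hΛdef⟩ : ∃ L : ℝ, L = CΛ * (ACForm.logM (2 * s') : ℝ) ^ d' := ⟨_, rfl⟩
  have hΛ0 : 0 ≤ Λ := by rw [hΛdef]; exact mul_nonneg hCΛ0.le (pow_nonneg (Nat.cast_nonneg _) _)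
  have hpiv : ∀ T : Finset ι, 2 * m₁ < #T → #T ≤ 2 * m₂ →
      2 * (#(upPivotal (fun y : ι → Bool => D.eval (fun e' => if e' ∈ T then y e' else false))) : ℝ) ≤ 2 ^ N * Λ := by
    intro T _ _
    have := two_mul_card_upPivotal_restrict_le D hD (d := d') (s := s') (hdep.trans (le_max_left _ _))
      (hsize.trans (by omega)) hd'1 (by omega) T
    rw [hΛdef, hCΛ]
    convert this using 1
    ring
  -- the tails
  have htail_up : ∑ ℓ ∈ Ioc j (2 * m₁), binomPMF (2 * m₁) (1 / 2) ℓ ≤ 1 / K := by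
    rw [hjm]
    refine (binom_half_upper_tail hm₁pos hw₁pos).trans ?_
    rw [div_le_div_iff₀ (by positivity) hK0, one_mul]
    have : ((K * j : ℕ) : ℝ) < ((w₁ ^ 2 : ℕ) : ℝ) := by exact_mod_cast hw₁sq
    push_cast at this
    have hm₁j : (m₁ : ℝ) ≤ j := by exact_mod_cast (show m₁ ≤ j by omega)
    calc (m₁ : ℝ) * K ≤ j * K := mul_le_mul_of_nonneg_right hm₁j hK0.le
      _ = K * j := mul_comm _ _
      _ ≤ (w₁ : ℝ) ^ 2 := this.le
  have htail_low : ∑ ℓ ∈ range t, binomPMF (2 * m₂) (1 / 2) ℓ ≤ 2 / K := by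
    refine (binom_half_lower_tail hm₂pos hw₂pos (le_of_eq hm₂.symm)).trans ?_
    rw [div_le_div_iff₀ (by positivity) hK0]
    have : ((K * t : ℕ) : ℝ) < ((w₂ ^ 2 : ℕ) : ℝ) := by exact_mod_cast hw₂sq
    push_cast at this
    have hm₂t : (m₂ : ℝ) ≤ 2 * t := by
      rw [hm₂]; push_cast
      have : (w₂ : ℝ) ≤ t := by exact_mod_cast hw₂t
      linarith
    calc (m₂ : ℝ) * K ≤ 2 * t * K := mul_le_mul_of_nonneg_right hm₂t hK0.le
      _ = 2 * (K * t) := by ring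
      _ ≤ 2 * (w₂ : ℝ) ^ 2 := by linarith
  -- the drift is small
  have hdrift_small : Λ * ((2 * m₂ : ℕ) - (2 * m₁ : ℕ) : ℝ) / (2 * ((2 * m₁ : ℕ) + 1)) ≤ ε / 2 := by
    -- numerator and denominator
    have hnum : ((2 * m₂ : ℕ) : ℝ) - (2 * m₁ : ℕ) ≤ 2 * (j : ℝ) ^ (1 - θ) + 4 * (Real.sqrt (2 * K) * Real.sqrt j) + 4 := by
      rw [hm₂, hm₁]; push_cast
      rw [Nat.cast_sub (by omega : w₁ ≤ j)]
      linarith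
    have hden : (j : ℝ) ≤ ((2 * m₁ : ℕ) : ℝ) + 1 := by
      rw [hm₁]; push_cast; rw [Nat.cast_sub (by omega : w₁ ≤ j)]
      have : 2 * (w₁ : ℝ) ≤ j := by exact_mod_cast hw₁j
      linarith
    have hden0 : (0 : ℝ) < 2 * (((2 * m₁ : ℕ) : ℝ) + 1) := by positivity
    -- `Λ ≤ CΛ (5 (c+2) log j)^d'`
    have hlogM : (ACForm.logM (2 * s') : ℝ) ≤ 5 * ((c : ℝ) + 2) * Real.log j := by
      have h1 := ACForm.logM_two_mul_le (s := s') (by omega)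
      have h2 : Real.log (s' : ℝ) ≤ ((c : ℝ) + 2) * Real.log j := by
        rw [← Real.log_rpow hjpos]
        refine Real.log_le_log (by positivity) ?_
        rw [hs']
        have hjc : (1 : ℝ) ≤ (j : ℝ) ^ c := one_le_pow₀ (by linarith)
        have : ((j : ℝ)) ^ ((c : ℝ) + 2) = (j : ℝ) ^ c * (j : ℝ) ^ 2 := by
          rw [Real.rpow_add hjpos, Real.rpow_natCast, Real.rpow_two]
        rw [this]; push_cast
        have hj2 : (4 : ℝ) ≤ (j : ℝ) ^ 2 := by nlinarith only [hjR]
        have : (j : ℝ) ^ c * 4 ≤ (j : ℝ) ^ c * (j : ℝ) ^ 2 := mul_le_mul_of_nonneg_left hj2 (by positivity)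
        linarith
      have hc5 : (0 : ℝ) ≤ 5 := by norm_num
      calc (ACForm.logM (2 * s') : ℝ) ≤ 5 * Real.log s' := h1
        _ ≤ 5 * (((c : ℝ) + 2) * Real.log j) := mul_le_mul_of_nonneg_left h2 hc5
        _ = _ := by ring
    have hlogM0 : (0 : ℝ) ≤ (ACForm.logM (2 * s') : ℝ) := Nat.cast_nonneg _
    have hΛle : Λ ≤ CΛ * (5 * ((c : ℝ) + 2)) ^ d' * (Real.log j) ^ d' := by
      rw [hΛdef, mul_assoc, ← mul_pow]
      exact mul_le_mul_of_nonneg_left (pow_le_pow_left₀ hlogM0 hlogM d') hCΛ0.le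
    -- powers of `j`
    have hjθ : (j : ℝ) ^ (1 - θ) = j * (j : ℝ) ^ (-θ) := by
      rw [show (1 - θ : ℝ) = 1 + -θ by ring, Real.rpow_add hjpos, Real.rpow_one]
    have hθ'le : (j : ℝ) ^ (-θ) ≤ (j : ℝ) ^ (-θ') :=
      Real.rpow_le_rpow_of_exponent_le (by linarith) (by rw [neg_le_neg_iff]; exact min_le_left _ _)
    have hhalf : Real.sqrt j = j * (j : ℝ) ^ (-(1 / 2 : ℝ)) := by
      rw [Real.sqrt_eq_rpow, show (1 / 2 : ℝ) = 1 + -(1 / 2 : ℝ) by norm_num, Real.rpow_add hjpos, Real.rpow_one]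
      norm_num
    have hhalf' : (j : ℝ) ^ (-(1 / 2 : ℝ)) ≤ (j : ℝ) ^ (-θ') :=
      Real.rpow_le_rpow_of_exponent_le (by linarith) (by rw [neg_le_neg_iff]; exact min_le_right _ _)
    have hone : (1 : ℝ) ≤ j * (j : ℝ) ^ (-θ') := by
      have : (j : ℝ) ^ (-(1 : ℝ)) ≤ (j : ℝ) ^ (-θ') :=
        Real.rpow_le_rpow_of_exponent_le (by linarith) (by
          rw [neg_le_neg_iff]; exact (min_le_right _ _).trans (by norm_num))
      rw [Real.rpow_neg_one] at this
      calc (1 : ℝ) = j * (j : ℝ)⁻¹ := by field_simp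
        _ ≤ j * (j : ℝ) ^ (-θ') := mul_le_mul_of_nonneg_left this hjpos.le
    have hpow0 : (0 : ℝ) ≤ (j : ℝ) ^ (-θ') := Real.rpow_nonneg hjpos.le _
    have hsq0 : (0 : ℝ) ≤ Real.sqrt (2 * K) := Real.sqrt_nonneg _
    have hnum' : ((2 * m₂ : ℕ) : ℝ) - (2 * m₁ : ℕ) ≤ 2 * (3 + 2 * Real.sqrt (2 * K)) * (j * (j : ℝ) ^ (-θ')) := by
      refine hnum.trans ?_
      rw [hjθ, hhalf]
      have e1 : (j : ℝ) * (j : ℝ) ^ (-θ) ≤ j * (j : ℝ) ^ (-θ') := mul_le_mul_of_nonneg_left hθ'le hjpos.le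
      have e2 : (j : ℝ) * (j : ℝ) ^ (-(1 / 2 : ℝ)) ≤ j * (j : ℝ) ^ (-θ') := mul_le_mul_of_nonneg_left hhalf' hjpos.le
      have e3 := mul_le_mul_of_nonneg_left e2 hsq0
      linarith only [e1, e3, hone]
    have hmain := hj₁ j hjj₁
    rw [hA] at hmain
    -- assemble: drift ≤ Λ · num / (2 j) ≤ A (log j)^d' j^{-θ'}
    have hlog0 : (0 : ℝ) ≤ Real.log j := Real.log_nonneg (by linarith)
    calc Λ * (((2 * m₂ : ℕ) : ℝ) - (2 * m₁ : ℕ)) / (2 * (((2 * m₁ : ℕ) : ℝ) + 1))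
        ≤ Λ * (2 * (3 + 2 * Real.sqrt (2 * K)) * (j * (j : ℝ) ^ (-θ'))) / (2 * j) := by
          refine div_le_div₀ (by positivity) (mul_le_mul_of_nonneg_left hnum' hΛ0) (by positivity) (by linarith)
      _ = Λ * (3 + 2 * Real.sqrt (2 * K)) * (j : ℝ) ^ (-θ') := by field_simp
      _ ≤ CΛ * (5 * ((c : ℝ) + 2)) ^ d' * (Real.log j) ^ d' * (3 + 2 * Real.sqrt (2 * K)) * (j : ℝ) ^ (-θ') := by
          gcongr
      _ = CΛ * (5 * ((c : ℝ) + 2)) ^ d' * (3 + 2 * Real.sqrt (2 * K)) * (Real.log j) ^ d' * (j : ℝ) ^ (-θ') := by ring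
      _ ≤ ε / 2 := hmain
  -- the three inequalities (kept late: they are huge terms)
  have hup := subcube_sum_le (ι := ι) hmono (r := 2 * m₁) (j := j) hr₁N hjN
  have hlow := le_subcube_sum (ι := ι) hmono (r := 2 * m₂) (t := t) hr₂N htN
  have hdrift := subcube_avg_le_of_le (ι := ι) hmono hr₁r₂ hr₂N hΛ0 hpiv
  -- combine everything
  have hC1 : (0 : ℝ) < (N.choose (2 * m₁) : ℝ) * 2 ^ N := by
    have := Nat.choose_pos hr₁N; positivity
  have hC2 : (0 : ℝ) < (N.choose (2 * m₂) : ℝ) * 2 ^ N := by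
    have := Nat.choose_pos hr₂N; positivity
  have havg1 : ((∑ T ∈ powersetCard (2 * m₁) (univ : Finset ι),
      #(univ.filter fun y : ι → Bool => D.eval (fun e => if e ∈ T then y e else false) = true) : ℕ) : ℝ) /
      ((N.choose (2 * m₁) : ℝ) * 2 ^ N) ≤ sliceAvg D.eval j + 1 / K := by
    rw [div_le_iff₀ hC1]
    refine hup.trans ?_
    have hh : sliceAvg D.eval j + ∑ ℓ ∈ Ioc j (2 * m₁), binomPMF (2 * m₁) (1 / 2) ℓ ≤ sliceAvg D.eval j + 1 / K := by
      linarith only [htail_up]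
    calc _ = (sliceAvg D.eval j + ∑ ℓ ∈ Ioc j (2 * m₁), binomPMF (2 * m₁) (1 / 2) ℓ) *
          ((N.choose (2 * m₁) : ℝ) * 2 ^ N) := mul_comm _ _
      _ ≤ _ := mul_le_mul_of_nonneg_right hh hC1.le
  have havg2 : sliceAvg D.eval t * (1 - 2 / K) ≤ ((∑ T ∈ powersetCard (2 * m₂) (univ : Finset ι),
      #(univ.filter fun y : ι → Bool => D.eval (fun e => if e ∈ T then y e else false) = true) : ℕ) : ℝ) /
      ((N.choose (2 * m₂) : ℝ) * 2 ^ N) := by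
    rw [le_div_iff₀ hC2]
    refine le_trans ?_ hlow
    have hh : sliceAvg D.eval t * (1 - 2 / K) ≤
        sliceAvg D.eval t * (1 - ∑ ℓ ∈ range t, binomPMF (2 * m₂) (1 / 2) ℓ) :=
      mul_le_mul_of_nonneg_left (by linarith only [htail_low]) (sliceAvg_nonneg D.eval t)
    calc _ = ((N.choose (2 * m₂) : ℝ) * 2 ^ N) * (sliceAvg D.eval t * (1 - 2 / K)) := mul_comm _ _
      _ ≤ _ := mul_le_mul_of_nonneg_left hh hC2.le
  have ha1 := sliceAvg_le_one D.eval t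
  have ha0 := sliceAvg_nonneg D.eval t
  have hK2 : sliceAvg D.eval t * (2 / K) ≤ 2 / K := by
    calc sliceAvg D.eval t * (2 / K) ≤ 1 * (2 / K) := mul_le_mul_of_nonneg_right ha1 (by positivity)
      _ = 2 / K := one_mul _
  have h3K : (1 : ℝ) / K + 2 / K = 3 / K := by ring
  have hexp : sliceAvg D.eval t * (1 - 2 / K) = sliceAvg D.eval t - sliceAvg D.eval t * (2 / K) := by ring
  rw [hexp] at havg2
  linarith only [havg1, havg2, hdrift, hdrift_small, hK2, hKε, h3K, ha0]

end Summit.PneNP.PneNP.Theorems.ShallowSliceBound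

end
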